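import Summits.ValiantsHypothesis.ValiantsHypothesis.Theorems.LacunarySymmetroidMatrixDescartesCensusNineteenLift

/-!
# `MatrixDescartes` census — DOOR A at `(3,4)`: the A′ BRIDGE (a double-root / fully alternating eighteen lifts to a nineteen)

HONEST FRAMING.  Object-search cell `pub-symmetroid`, route `LacunarySymmetroid`; this file sits beside ONE typed statement,
the route item `Theses.LacunarySymmetroid.DoorA34` (stmt-ValiantsHypothesis-19980, `= DoorA34 = PosRootLawAt 3 4 18`: «every
`4`-term real symmetric `3 × 3` lacunary pencil has at most `18` distinct positive det-roots»), which is OPEN and asserted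
nowhere.  It proves, ONCE FOR ALL SUPPORTS, the first of two elementary perturbation statements that turn BOUNDARY STRATA of
the `V = 19` cell into counterexample currency — the `(3,4)` counterpart of the `(2,6)` file `…CensusNineteenLift` (the
companion `…CensusDoorA34NullEndLift` is the null-end lift):

* `det_add_smul_fin_three` — `det (A + c·T) = det A + c·tr(adj A·T) + c²·tr(adj T·A) + c³·det T` (`3 × 3`).
* `exists_nineteen_of_eighteen_of_countP` — **A′ BRIDGE at `(3,4)`**: if `det (Σ_l X^{d l} S l)` (`S l` real symmetric
  `3 × 3`) has `≥ 18` DISTINCT positive roots and `≥ 19` counted WITH MULTIPLICITY, then some real symmetric pencil ON THE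
  SAME exponent vector `d` has `≥ 19` distinct positive det-roots.  Proof: `#supp det ≤ 20` and Descartes force the count with
  multiplicity to be exactly `19`, i.e. `17` simple roots and one double root `r`; the one-letter deformation
  `S 0 ↦ S 0 + ε T` moves `det` by `ε x^{d₀} tr(adj F(x)·T) + ε² x^{2d₀} tr(adj T·F(x)) + ε³ x^{3d₀} det T`, and `T` is read
  off `F(r)` — `T = −σ·adj F(r)` if `adj F(r) ≠ 0` (first order `−σ‖adj F(r)‖²`), a diagonal `T` built from a non-zero
  diagonal entry `F(r)ᵢᵢ` if `adj F(r) = 0 ≠ F(r)` (second order `−σ F(r)ᵢᵢ²`), `T = diag(1,1,−σ)` if `F(r) = 0` (third order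
  `−σ`) — so that the leading term at `r` has the sign required by the class-level splitting theorem
  `exists_card_posRoots_of_double_root_deformation` (`…CensusSignChangeCount`).
* `exists_nineteen_of_eighteen_of_signVariations` — the same from `Var(det) ≥ 19` (all `20` triple-sum coefficients
  present and alternating) and `≥ 18` distinct positive roots (Descartes with parity).
* `countP_le_18_of_posRootLawOn`, `signVariations_le_18_of_posRootLawOn` — the DOOR-A READING: on a support where the
  row `PosRootLawOn 3 4 18 d` holds, a (hypothetical) eighteen has only simple positive roots and `Var ≤ 18`.

Read contrapositively, a kernel proof of `PosRootLawOn 3 4 18 d` excludes double-root eighteens and fully alternating eighteens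
on `d`.  NOTHING here asserts that such boundary objects exist or do not exist; nothing bounds `ζ_sym(3,4)`; `DoorA34` stays
OPEN; nothing bears on `MatrixDescartes` (stmt-ValiantsHypothesis-18050) or on `VP ≠ VNP`.

[folklore] Descartes' rule with parity; transversal splitting of a double root; no citation is needed.
-/

-- `Summit.ValiantsHypothesis.ValiantsHypothesis.…` repeats a component by the D-0017 layout
-- (single-conjunct summit), which the `dupNamespace` linter flags; the name is mandated.
set_option linter.dupNamespace false

namespace Summit.ValiantsHypothesis.ValiantsHypothesis.Theorems.LacunarySymmetroidMatrixDescartes.Census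

open Polynomial Finset Filter
open scoped BigOperators Polynomial Matrix Topology
open Summit.ValiantsHypothesis.ValiantsHypothesis.Theorems.MatrixDescartes.Negative (PosRootLawAt)
open Summit.ValiantsHypothesis.ValiantsHypothesis.Theorems.SymmetroidDescartes (eval_det_pencil)

/-! ## `3 × 3` determinant expansions -/

/-- `3 × 3` expansion: `det (A + c·T) = det A + c·tr(adj A · T) + c²·tr(adj T · A) + c³·det T`. [folklore] -/
theorem det_add_smul_fin_three (A T : Matrix (Fin 3) (Fin 3) ℝ) (c : ℝ) :
    (A + c • T).det = A.det + c * (A.adjugate * T).trace + c ^ 2 * (T.adjugate * A).trace + c ^ 3 * T.det := by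
  simp only [Matrix.det_fin_three, Matrix.adjugate_fin_three, Matrix.trace_fin_three, Matrix.mul_apply,
    Fin.sum_univ_three, Matrix.add_apply, Matrix.smul_apply, smul_eq_mul, Matrix.of_apply, Matrix.cons_val',
    Matrix.cons_val_zero, Matrix.cons_val_one, Matrix.cons_val_two, Matrix.empty_val', Matrix.cons_val_fin_one,
    Matrix.head_cons, Matrix.tail_cons, Matrix.head_fin_const]
  ring

/-- The deformed letter family `S' l = S l + [l = 0]·E` evaluates to `F(x) + x^{d 0}·E`. [folklore] -/
theorem sum_smul_perturb_three (d : Fin 4 → ℕ) (S : Fin 4 → Matrix (Fin 3) (Fin 3) ℝ)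
    (E : Matrix (Fin 3) (Fin 3) ℝ) (x : ℝ) :
    (∑ l, x ^ d l • (S l + if l = 0 then E else 0)) = (∑ l, x ^ d l • S l) + x ^ d 0 • E := by
  have h : ∀ l : Fin 4, x ^ d l • (S l + if l = 0 then E else 0)
      = x ^ d l • S l + (if l = 0 then x ^ d l • E else 0) := by
    intro l
    split_ifs <;> simp [smul_add]
  simp_rw [h, Finset.sum_add_distrib, Finset.sum_ite_eq', Finset.mem_univ, if_true]

/-! ## The A′ bridge at `(3,4)`: a double-root eighteen splits into a nineteen on the same support -/

/-- symmetric `3 × 3` matrices over `ℝ`: a non-zero one with vanishing adjugate has a non-zero diagonal entry. [folklore] -/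
theorem exists_diag_ne_zero_of_adjugate_eq_zero {A : Matrix (Fin 3) (Fin 3) ℝ} (hA : A.IsSymm)
    (hadj : A.adjugate = 0) (hne : A ≠ 0) : ∃ i, A i i ≠ 0 := by
  by_contra h
  push Not at h
  have hs : ∀ i j, A j i = A i j := fun i j => by
    have := congrFun (congrFun hA i) j
    simpa [Matrix.transpose_apply] using this
  -- the diagonal adjugate entries are `−A_ij²`
  have e0 := congrFun (congrFun hadj 0) 0
  have e1 := congrFun (congrFun hadj 1) 1
  have e2 := congrFun (congrFun hadj 2) 2
  simp only [Matrix.adjugate_fin_three, Matrix.of_apply, Matrix.cons_val', Matrix.cons_val_zero, Matrix.cons_val_one,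
    Matrix.cons_val_two, Matrix.empty_val', Matrix.cons_val_fin_one, Matrix.head_cons, Matrix.tail_cons,
    Matrix.head_fin_const, Matrix.zero_apply, h, zero_mul, mul_zero, zero_sub, sub_zero] at e0 e1 e2
  have h12 : A 1 2 = 0 := by
    have : A 1 2 * A 1 2 = 0 := by rw [hs 1 2] at e0; linarith
    exact mul_self_eq_zero.mp this
  have h02 : A 0 2 = 0 := by
    have : A 0 2 * A 0 2 = 0 := by rw [hs 0 2] at e1; linarith
    exact mul_self_eq_zero.mp this
  have h01 : A 0 1 = 0 := by
    have : A 0 1 * A 0 1 = 0 := by rw [hs 0 1] at e2; linarith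
    exact mul_self_eq_zero.mp this
  apply hne
  ext i j
  fin_cases i <;> fin_cases j
  · exact h 0
  · exact h01
  · exact h02
  · simpa [hs 0 1] using h01
  · exact h 1
  · exact h12
  · simpa [hs 0 2] using h02
  · simpa [hs 1 2] using h12
  · exact h 2

/-- for a SYMMETRIC `3 × 3` matrix `M`, `tr(M · M) = Σ M_ij² > 0` unless `M = 0`. [folklore] -/
theorem trace_mul_self_pos_of_isSymm {M : Matrix (Fin 3) (Fin 3) ℝ} (hM : M.IsSymm) (hne : M ≠ 0) :
    0 < (M * M).trace := by
  have hs : ∀ i j, M j i = M i j := fun i j => by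
    have := congrFun (congrFun hM i) j
    simpa [Matrix.transpose_apply] using this
  have hex : ∃ i j, M i j ≠ 0 := by
    by_contra h
    push Not at h
    exact hne (Matrix.ext fun i j => h i j)
  obtain ⟨i, j, hij⟩ := hex
  have key : (M * M).trace = ∑ i, ∑ j, M i j ^ 2 := by
    simp only [Matrix.trace, Matrix.diag, Matrix.mul_apply]
    refine Finset.sum_congr rfl fun i _ => Finset.sum_congr rfl fun j _ => ?_
    rw [hs j i]; ring
  rw [key]
  have h1 : M i j ^ 2 ≤ ∑ j', M i j' ^ 2 :=
    Finset.single_le_sum (f := fun j' => M i j' ^ 2) (fun _ _ => sq_nonneg _) (Finset.mem_univ j)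
  have h2 : (∑ j', M i j' ^ 2) ≤ ∑ i', ∑ j', M i' j' ^ 2 :=
    Finset.single_le_sum (f := fun i' => ∑ j', M i' j' ^ 2) (fun _ _ => Finset.sum_nonneg fun _ _ => sq_nonneg _)
      (Finset.mem_univ i)
  have h0 : 0 < M i j ^ 2 := by positivity
  linarith

/-- the diagonal deformation used when `adj F(r) = 0 ≠ F(r)` — `diag` with `0` at `i`, `1` at `i+1`, `w` at `i+2` — satisfies
`tr(adj (diag) · A) = w · A i i`, and it is symmetric (`Matrix.isSymm_diagonal`). [folklore] -/
theorem trace_adjugate_diagonal_three_mul (i : Fin 3) (w : ℝ) (A : Matrix (Fin 3) (Fin 3) ℝ) :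
    ((Matrix.diagonal fun m : Fin 3 => if m = i then (0 : ℝ) else if m = i + 1 then 1 else w).adjugate * A).trace
      = w * A i i := by
  fin_cases i <;>
  · simp only [Matrix.adjugate_fin_three, Matrix.trace_fin_three, Matrix.mul_apply, Fin.sum_univ_three,
      Matrix.diagonal_apply, Matrix.of_apply, Matrix.cons_val', Matrix.cons_val_zero, Matrix.cons_val_one,
      Matrix.cons_val_two, Matrix.empty_val', Matrix.cons_val_fin_one, Matrix.head_cons, Matrix.tail_cons,
      Matrix.head_fin_const]
    simp (config := { decide := true })
    try ring

/-- **A′ BRIDGE at `(3,4)` (multiplicity form).**  Let `f = det (Σ_l X^{d l} S l)` with all `S l` real symmetric `3 × 3`.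
If `f` has at least `18` distinct positive roots and at least `19` positive roots counted with multiplicity, then some real
symmetric pencil `S'` on the SAME exponent vector `d` has at least `19` distinct positive det-roots. [folklore] -/
theorem exists_nineteen_of_eighteen_of_countP (d : Fin 4 → ℕ) (S : Fin 4 → Matrix (Fin 3) (Fin 3) ℝ)
    (hS : ∀ l, (S l).IsSymm) {f : ℝ[X]}
    (hf : f = ((∑ l, (X : ℝ[X]) ^ d l • (S l).map C)).det)
    (hZ : 18 ≤ (f.roots.toFinset.filter (fun t => 0 < t)).card)
    (hZm : 19 ≤ f.roots.countP (fun t => 0 < t)) :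
    ∃ S' : Fin 4 → Matrix (Fin 3) (Fin 3) ℝ, (∀ l, (S' l).IsSymm) ∧
      19 ≤ ((((∑ l, (X : ℝ[X]) ^ d l • (S' l).map C)).det).roots.toFinset.filter (fun t => 0 < t)).card := by
  classical
  have hf0 : f ≠ 0 := by rintro rfl; simp at hZ
  -- multiplicity count is exactly 19 (`#supp ≤ 20`, Descartes)
  have hZm19 : f.roots.countP (fun t => 0 < t) = 18 + 1 := by
    have h1 := f.roots_countP_pos_le_signVariations
    have h2 := Literature.Computability.AlgebraicComplexity.signVariations_lt_card_support hf0
    have h3 := card_support_det_three_four_le d S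
    rw [← hf] at h3
    omega
  -- the class: determinants of symmetric pencils on `d`
  let P : ℝ[X] → Prop := fun g => ∃ S' : Fin 4 → Matrix (Fin 3) (Fin 3) ℝ, (∀ l, (S' l).IsSymm) ∧
    g = ((∑ l, (X : ℝ[X]) ^ d l • (S' l).map C)).det
  have hPf : P f := ⟨S, hS, hf⟩
  suffices h : ∃ f' : ℝ[X], P f' ∧ 18 + 1 ≤ (f'.roots.toFinset.filter (fun t => 0 < t)).card by
    obtain ⟨f', ⟨S', hS', rfl⟩, h19⟩ := h
    exact ⟨S', hS', h19⟩
  refine exists_card_posRoots_of_double_root_deformation P f 18 hPf hZ hZm19 ?_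
  intro r hr hm σ hσ
  have hfr : f.eval r = 0 := ((rootMultiplicity_pos hf0).mp (by omega)).eq_zero
  -- evaluation of the pencil
  let A : ℝ → Matrix (Fin 3) (Fin 3) ℝ := fun x => ∑ l, x ^ d l • S l
  have hfA : ∀ x, f.eval x = (A x).det := fun x => by rw [hf]; exact eval_det_pencil S d x
  have hAsymm : ∀ x, (A x).IsSymm := by
    intro x
    show (∑ l, x ^ d l • S l).IsSymm
    unfold Matrix.IsSymm
    rw [Matrix.transpose_sum]
    exact Finset.sum_congr rfl fun l _ => by rw [Matrix.transpose_smul, hS l]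
  -- the deformed family for a symmetric direction `T`
  let Sp : Matrix (Fin 3) (Fin 3) ℝ → ℝ → Fin 4 → Matrix (Fin 3) (Fin 3) ℝ :=
    fun T ε l => S l + if l = 0 then ε • T else 0
  let g : Matrix (Fin 3) (Fin 3) ℝ → ℝ → ℝ[X] := fun T ε => ((∑ l, (X : ℝ[X]) ^ d l • (Sp T ε l).map C)).det
  have hg_eval : ∀ T ε x, (g T ε).eval x = f.eval x + (ε * x ^ d 0) * ((A x).adjugate * T).trace
      + (ε * x ^ d 0) ^ 2 * (T.adjugate * A x).trace + (ε * x ^ d 0) ^ 3 * T.det := by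
    intro T ε x
    show (((∑ l, (X : ℝ[X]) ^ d l • (Sp T ε l).map C)).det).eval x = _
    rw [eval_det_pencil (Sp T ε) d x, hfA x]
    show (∑ l, x ^ d l • (S l + if l = 0 then ε • T else 0)).det = _
    rw [sum_smul_perturb_three, smul_smul, mul_comm (x ^ d 0) ε]
    exact det_add_smul_fin_three (A x) T (ε * x ^ d 0)
  have hgP : ∀ T, T.IsSymm → ∀ ε, P (g T ε) := by
    intro T hT ε
    refine ⟨Sp T ε, fun l => ?_, rfl⟩
    show (S l + if l = 0 then ε • T else 0).IsSymm
    split_ifs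
    · exact (hS l).add (hT.smul ε)
    · rw [add_zero]; exact hS l
  have hglim : ∀ T x, Tendsto (fun ε => (g T ε).eval x) (𝓝[>] 0) (𝓝 (f.eval x)) := by
    intro T x
    simp_rw [hg_eval T]
    have hc : Continuous (fun ε : ℝ => f.eval x + (ε * x ^ d 0) * ((A x).adjugate * T).trace
        + (ε * x ^ d 0) ^ 2 * (T.adjugate * A x).trace + (ε * x ^ d 0) ^ 3 * T.det) := by
      fun_prop
    have := hc.tendsto 0
    simp only [zero_mul, ne_eq, OfNat.ofNat_ne_zero, not_false_eq_true, zero_pow, add_zero] at this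
    exact this.mono_left nhdsWithin_le_nhds
  -- it remains to choose `T` with the required sign at `r`
  suffices hT : ∃ T : Matrix (Fin 3) (Fin 3) ℝ, T.IsSymm ∧
      ∀ᶠ ε in 𝓝[>] (0 : ℝ), ((ε * r ^ d 0) * ((A r).adjugate * T).trace
        + (ε * r ^ d 0) ^ 2 * (T.adjugate * A r).trace + (ε * r ^ d 0) ^ 3 * T.det) * σ < 0 by
    obtain ⟨T, hT, hTr⟩ := hT
    refine ⟨g T, hgP T hT, hglim T, ?_⟩
    filter_upwards [hTr] with ε hε
    rwa [hg_eval, hfr, zero_add]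
  have hc0 : 0 < r ^ d 0 := pow_pos hr _
  -- generic tool: `ε ↦ ε^j · c · (L + ε·M(ε))` with `L σ < 0`-type leading term is eventually negative
  have lead : ∀ (L : ℝ) (M : ℝ → ℝ), Continuous M → L < 0 → ∀ j : ℕ,
      ∀ᶠ ε in 𝓝[>] (0 : ℝ), ε ^ j * (L + ε * M ε) < 0 := by
    intro L M hM hL j
    have hlim : Tendsto (fun ε : ℝ => L + ε * M ε) (𝓝[>] 0) (𝓝 (L + 0 * M 0)) := by
      refine Filter.Tendsto.mono_left ?_ nhdsWithin_le_nhds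
      exact tendsto_const_nhds.add ((continuous_id.mul hM).tendsto 0)
    rw [zero_mul, add_zero] at hlim
    have hev := hlim.eventually (gt_mem_nhds hL)
    filter_upwards [hev, self_mem_nhdsWithin] with ε hε (hε0 : 0 < ε)
    exact mul_neg_of_pos_of_neg (pow_pos hε0 j) hε
  by_cases hadj : (A r).adjugate = 0
  · by_cases hA : A r = 0
    · -- `F(r) = 0`: use `det T = −σ`
      refine ⟨Matrix.diagonal ![1, 1, -σ], Matrix.isSymm_diagonal _, ?_⟩
      have hdet : (Matrix.diagonal ![(1 : ℝ), 1, -σ]).det = -σ := by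
        rw [Matrix.det_diagonal]; simp [Fin.prod_univ_three]
      have key : ∀ ε : ℝ, ((ε * r ^ d 0) * ((A r).adjugate * Matrix.diagonal ![(1 : ℝ), 1, -σ]).trace
          + (ε * r ^ d 0) ^ 2 * ((Matrix.diagonal ![(1 : ℝ), 1, -σ]).adjugate * A r).trace
          + (ε * r ^ d 0) ^ 3 * (Matrix.diagonal ![(1 : ℝ), 1, -σ]).det) * σ
          = ε ^ 3 * (-(r ^ d 0) ^ 3 * σ ^ 2 + ε * 0) := by
        intro ε; rw [hadj, hA, hdet]; simp; ring
      simp_rw [key]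
      refine lead _ (fun _ => 0) continuous_const ?_ 3
      have : 0 < (r ^ d 0) ^ 3 * σ ^ 2 := by positivity
      linarith
    · -- `adj F(r) = 0 ≠ F(r)`: second order, diagonal `T` from a non-zero diagonal entry
      obtain ⟨i, hi⟩ := exists_diag_ne_zero_of_adjugate_eq_zero (hAsymm r) hadj hA
      refine ⟨(Matrix.diagonal fun m : Fin 3 => if m = i then (0 : ℝ) else if m = i + 1 then 1 else (-σ * (A r) i i)), Matrix.isSymm_diagonal _, ?_⟩
      have key : ∀ ε : ℝ, ((ε * r ^ d 0) * ((A r).adjugate * (Matrix.diagonal fun m : Fin 3 => if m = i then (0 : ℝ) else if m = i + 1 then 1 else (-σ * (A r) i i))).trace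
          + (ε * r ^ d 0) ^ 2 * (((Matrix.diagonal fun m : Fin 3 => if m = i then (0 : ℝ) else if m = i + 1 then 1 else (-σ * (A r) i i))).adjugate * A r).trace
          + (ε * r ^ d 0) ^ 3 * ((Matrix.diagonal fun m : Fin 3 => if m = i then (0 : ℝ) else if m = i + 1 then 1 else (-σ * (A r) i i))).det) * σ
          = ε ^ 2 * (-((r ^ d 0) ^ 2 * (σ * (A r) i i) ^ 2)
              + ε * ((r ^ d 0) ^ 3 * ((Matrix.diagonal fun m : Fin 3 => if m = i then (0 : ℝ) else if m = i + 1 then 1 else (-σ * (A r) i i))).det * σ)) := by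
        intro ε; rw [hadj, trace_adjugate_diagonal_three_mul]; simp; ring
      simp_rw [key]
      refine lead _ (fun _ => (r ^ d 0) ^ 3 * ((Matrix.diagonal fun m : Fin 3 => if m = i then (0 : ℝ) else if m = i + 1 then 1 else (-σ * (A r) i i))).det * σ) continuous_const ?_ 2
      have h1 : 0 < (σ * (A r) i i) ^ 2 := by have := mul_ne_zero hσ hi; positivity
      have : 0 < (r ^ d 0) ^ 2 * (σ * (A r) i i) ^ 2 := by positivity
      linarith
  · -- `adj F(r) ≠ 0`: first order, `T = −σ · adj F(r)`
    have hsymadj : (A r).adjugate.IsSymm := (hAsymm r).adjugate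
    refine ⟨(-σ) • (A r).adjugate, hsymadj.smul _, ?_⟩
    have hpos : 0 < ((A r).adjugate * (A r).adjugate).trace := trace_mul_self_pos_of_isSymm hsymadj hadj
    set Tm := (-σ) • (A r).adjugate with hTm
    have htr : ((A r).adjugate * Tm).trace = -σ * ((A r).adjugate * (A r).adjugate).trace := by
      rw [hTm, Matrix.mul_smul, Matrix.trace_smul, smul_eq_mul]
    have key : ∀ ε : ℝ, ((ε * r ^ d 0) * ((A r).adjugate * Tm).trace
        + (ε * r ^ d 0) ^ 2 * (Tm.adjugate * A r).trace + (ε * r ^ d 0) ^ 3 * Tm.det) * σ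
        = ε ^ 1 * (-(r ^ d 0 * σ ^ 2 * ((A r).adjugate * (A r).adjugate).trace)
            + ε * ((r ^ d 0) ^ 2 * (Tm.adjugate * A r).trace * σ + ε * ((r ^ d 0) ^ 3 * Tm.det * σ))) := by
      intro ε; rw [htr]; ring
    simp_rw [key]
    refine lead _ (fun ε => (r ^ d 0) ^ 2 * (Tm.adjugate * A r).trace * σ + ε * ((r ^ d 0) ^ 3 * Tm.det * σ))
      (by fun_prop) ?_ 1
    have : 0 < r ^ d 0 * σ ^ 2 * ((A r).adjugate * (A r).adjugate).trace := by
      have : 0 < σ ^ 2 := by positivity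
      positivity
    linarith

/-- **A′ BRIDGE at `(3,4)` (sign-variation form).**  If `f = det (Σ_l X^{d l} S l)` (`S l` symmetric `3 × 3`) has at least
`18` distinct positive roots and `Var(f) ≥ 19` — all `20` triple-sum coefficients present and alternating — then some symmetric
pencil on the same `d` has `19` distinct positive det-roots.  (`Var = #Z₊^{mult} + 2j ≤ 19` and `#Z₊^{mult} ≥ 18` force
`#Z₊^{mult} = 19`.) [folklore] -/
theorem exists_nineteen_of_eighteen_of_signVariations (d : Fin 4 → ℕ) (S : Fin 4 → Matrix (Fin 3) (Fin 3) ℝ)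
    (hS : ∀ l, (S l).IsSymm) {f : ℝ[X]}
    (hf : f = ((∑ l, (X : ℝ[X]) ^ d l • (S l).map C)).det)
    (hZ : 18 ≤ (f.roots.toFinset.filter (fun t => 0 < t)).card)
    (hV : 19 ≤ f.signVariations) :
    ∃ S' : Fin 4 → Matrix (Fin 3) (Fin 3) ℝ, (∀ l, (S' l).IsSymm) ∧
      19 ≤ ((((∑ l, (X : ℝ[X]) ^ d l • (S' l).map C)).det).roots.toFinset.filter (fun t => 0 < t)).card := by
  classical
  have hf0 : f ≠ 0 := by rintro rfl; simp at hZ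
  obtain ⟨j, hj⟩ := Literature.Algebra.Polynomial.Descartes.signVariations_eq_countP_add_two_mul f
  have h2 := Literature.Computability.AlgebraicComplexity.signVariations_lt_card_support hf0
  have h3 := card_support_det_three_four_le d S
  rw [← hf] at h3
  -- distinct ≤ with multiplicity
  have h4 : (f.roots.toFinset.filter (fun t => 0 < t)).card ≤ f.roots.countP (fun t => 0 < t) := by
    rw [← Multiset.toFinset_filter, Multiset.countP_eq_card_filter]
    exact Multiset.toFinset_card_le _
  refine exists_nineteen_of_eighteen_of_countP d S hS hf hZ ?_
  omega

/-- **DOOR-A READING (multiplicities).**  On a support `d` where the row `PosRootLawOn 3 4 18 d` holds, a symmetric `(3,4)`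
pencil with `18` distinct positive det-roots has ALL of them simple (`≤ 18` counted with multiplicity): a double-root eighteen
would split into a nineteen on `d`. [folklore] -/
theorem countP_le_18_of_posRootLawOn {d : Fin 4 → ℕ} (hd : PosRootLawOn 3 4 18 d)
    (S : Fin 4 → Matrix (Fin 3) (Fin 3) ℝ) (hS : ∀ l, (S l).IsSymm)
    (h18 : 18 ≤ ((((∑ l, (X : ℝ[X]) ^ d l • (S l).map C)).det).roots.toFinset.filter (fun t => 0 < t)).card) :
    (((∑ l, (X : ℝ[X]) ^ d l • (S l).map C)).det).roots.countP (fun t => 0 < t) ≤ 18 := by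
  by_contra h
  obtain ⟨S', hS', h19⟩ := exists_nineteen_of_eighteen_of_countP d S hS rfl h18 (by omega)
  have := hd S' hS'
  omega

/-- **DOOR-A READING (sign variations).**  On a support `d` where `PosRootLawOn 3 4 18 d` holds, a symmetric `(3,4)` pencil with
`18` distinct positive det-roots has `Var(det) ≤ 18` — it is NOT fully alternating. [folklore] -/
theorem signVariations_le_18_of_posRootLawOn {d : Fin 4 → ℕ} (hd : PosRootLawOn 3 4 18 d)
    (S : Fin 4 → Matrix (Fin 3) (Fin 3) ℝ) (hS : ∀ l, (S l).IsSymm)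
    (h18 : 18 ≤ ((((∑ l, (X : ℝ[X]) ^ d l • (S l).map C)).det).roots.toFinset.filter (fun t => 0 < t)).card) :
    (((∑ l, (X : ℝ[X]) ^ d l • (S l).map C)).det).signVariations ≤ 18 := by
  by_contra h
  obtain ⟨S', hS', h19⟩ := exists_nineteen_of_eighteen_of_signVariations d S hS rfl h18 (by omega)
  have := hd S' hS'
  omega

end Summit.ValiantsHypothesis.ValiantsHypothesis.Theorems.LacunarySymmetroidMatrixDescartes.Census
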